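import Summits.AtomisticToContinuum.Crystallization.Theorems.FreeSplittingCertificatesStrictSplittingRuleP1FarCellLoad20
import Summits.AtomisticToContinuum.Crystallization.Theorems.FreeSplittingCertificatesStrictSplittingRuleP1FarCellDefect20

/-!
# `StrictSplittingRule` (stmt-AtomisticToContinuum-12560): THE (B∃) TAIL FROM `20a` — the per-cell budget of every cell `≥ 20a` from the base, and the endpoint with (B∃) asked for the LOADED cells of the `20a` box (P1 interpolant object, part 98)

Route `FreeSplittingCertificates`, crux r3 `StrictSplittingRule` (H12⋆ = `stub_coreJointCoercive`), unit b2b-freesplit-B gen 40.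
VALUE = a kernel theorem that RETIRES AN EXTERNAL ENGINE.  Part 90's `farCell_budget` (every cell `≥ 44a`) left the per-cell budget (B∃) on
`[11.9a, 45.5a]` to the closed-form tail engine celltail.py (HOME CERT §31 (c)); here the kernel reaches `20a`, within range of the direct
per-cell certifier cellval.py (rule v31, window extended by the gen-40 shell runs to `rc ≤ 21.0a`, HOME CERT §39), so celltail.py is no
longer load-bearing.  Per cell: readout `≤ (31/200)|G|²_F·J_T` (parts 96 + 88/89) and defect `≤ κ(19/8)·0.001462·|G|²_F·J_T` (part 97):
`0.16036 ≤ κ·5/48 = 0.16083`.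
* **`farCell_budget20`** — the body of (B∃) for EVERY cell whose vertices are `≥ 20a` from `y_p`, `θ = θv = p1ThetaX`;
* `p1CellBox20`, `far_of_not_mem_cellBox20`, **`coreJointCoercive_cell_of_certificates₁₃`** — part 93's endpoint with (B∃_fin) asked only
  for the cells of the `20a` box `Icc(p.1 ± 27) × Icc(p.2.1 ± 35) × Icc(p.2.2 ± 24)` with a vertex within `20a` (≈ 9 % of the `44a` family)
  THAT CARRY LOAD under the chosen allocation — literally the cells the certifier allocates to; unloaded cells are part 97's `defect_only_budget`.
NOT a proof of H12⋆ (five finite hypotheses verified outside the kernel), NOT summit progress.  [folklore]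
-/

noncomputable section

open Set Function Metric MeasureTheory Filter Topology
open scoped BigOperators NNReal ENNReal Classical

namespace Summit.AtomisticToContinuum.Crystallization.Theorems.StrictSplittingRuleBirth

open Literature.MathematicalPhysics.StatisticalMechanics
open Summit.AtomisticToContinuum.Crystallization.Theorems.PalmUnimodularRigidity.LayeredLawsSelectHcp

/-! ## The per-cell budget of every cell `≥ 20a` from the base -/

/-- **THE (B∃) TAIL LEMMA FROM `20a` (per-cell budget, in the kernel).**  For the hcp family minimiser `(a,h)`, ANY base site `p`, every cell `T`
whose four vertices are `≥ 20a` from `y_p`, and every `G`: the body of hypothesis (B∃) holds with the exact-rule allocation `θ = θv = p1ThetaX`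
— readout load of the pinned far shares + exact radial defect `≤ κ(5/48)|G|²_F·J_T` (`31/200` by the class forms of parts 88/89, defect
`≤ κ(19/8)·0.001462` by the circumradius form).  NOT a proof of H12⋆, NOT summit progress. -/
theorem farCell_budget20 {a h : ℝ} (ha : 0 < a) (hh : 0 < h) (hfam : HcpFamilyMin a h) (p : ℤ × ℤ × ℤ) (T : (ℤ × ℤ × ℤ) × Fin 6)
    (hfar : ∀ m : Fin 4, 20 * a ≤ ‖hcpSite a h (T.1 + p1VertOff (p1Par T.1) T.2 m) - hcpSite a h p‖) (G : Fin 3 → Fin 3 → ℝ) :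
      (∑ᶠ e : (ℤ × ℤ × ℤ) × (ℤ × ℤ × ℤ), p1ThetaX a h p e T * p1FarW a h (p1Phi0 p) p e *
          fpSq (fun k => (hcpSite a h (e.1 + e.2) 0 - hcpSite a h e.1 0) * G 0 k +
            (hcpSite a h (e.1 + e.2) 1 - hcpSite a h e.1 1) * G 1 k + (hcpSite a h (e.1 + e.2) 2 - hcpSite a h e.1 2) * G 2 k)) +
      (∑ᶠ e : (ℤ × ℤ × ℤ) × (ℤ × ℤ × ℤ), p1ThetaX a h p e T *
          (∑ i : Fin 3, (2 / 3) * ((if e.2 = p1RouteOff e.1 i then p1FarWv a h (p1Phi0 p) p e.1 else 0) +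
            (if p1RouteOff (e.1 - (p1SV - e.2)) i = p1SV - e.2 then p1FarWv a h (p1Phi0 p) p (e.1 - (p1SV - e.2)) else 0))) *
          fpSq (fun k => (hcpSite a h (e.1 + e.2) 0 - hcpSite a h e.1 0) * G 0 k +
            (hcpSite a h (e.1 + e.2) 1 - hcpSite a h e.1 1) * G 1 k + (hcpSite a h (e.1 + e.2) 2 - hcpSite a h e.1 2) * G 2 k)) +
      p1CellDefectG a h (fun y k l => (193 / 125) * ((7 * (5 / 4 : ℝ) + 3 / 4) / 4) * fpChi ((81 / 20 * a) ^ 2) ((27 / 5 * a) ^ 2) (y - fun k => hcpSite a h p k) ^ 2 *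
          (fpSq (y - fun k => hcpSite a h p k))⁻¹ ^ 5 * ((y - fun k => hcpSite a h p k) k * (y - fun k => hcpSite a h p k) l)) T G ≤
      (193 / 125) * ((5 / 2 * (1 / 24 * fpSymSq G) + 5 / 2 * (1 / 24 * (fpFrob G - fpSymSq G))) *
        ∫ y in p1RealCell a h T, fpChi ((81 / 20 * a) ^ 2) ((27 / 5 * a) ^ 2) (y - fun k => hcpSite a h p k) ^ 2 * (fpSq (y - fun k => hcpSite a h p k))⁻¹ ^ 3) := by
  -- the box
  obtain ⟨hA, hH⟩ := hcpFamilyMin_enclosure ha hh hfam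
  rw [abs_sub_le_iff] at hA hH
  obtain ⟨hA1, hA2⟩ := hA
  obtain ⟨hH1, hH2⟩ := hH
  obtain ⟨hρ1, hρ2⟩ := ratioBox_of_hcpFamilyMin ha hh hfam
  have ha1 : 97119 / 100000 ≤ a := by linarith
  have hh1 : 79284 / 100000 ≤ h := by linarith
  have hh2 : h ≤ 79304 / 100000 := by linarith
  -- Step 1: legs ↦ vertex pairs
  rw [finsum_eq_sum_pairs T _ (fun e he => by rw [p1ThetaX_eq_zero he, zero_mul, zero_mul]),
    finsum_eq_sum_pairs T _ (fun e he => by rw [p1ThetaX_eq_zero he, zero_mul, zero_mul]), ← Finset.sum_add_distrib]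
  simp only [← Finset.sum_add_distrib]
  -- Step 2: each pair against `J_T · p1LoadCoef · Σ_k ⟪δ, G_k⟫²`, summed: the class form column by column
  have hpairs := fun m m' => pair_term_le20 ha hh hfam (p1Phi0 p) p T hfar G m m'
  have hsum : ∑ m : Fin 4, ∑ m' : Fin 4, p1CellJ a h p T * (p1LoadCoef a h (p1Par T.1) T.2 m m' *
        ((p1EdgeVec a h (p1Par T.1) T.2 m m' 0 * G 0 0 + p1EdgeVec a h (p1Par T.1) T.2 m m' 1 * G 1 0 + p1EdgeVec a h (p1Par T.1) T.2 m m' 2 * G 2 0) ^ 2 +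
         (p1EdgeVec a h (p1Par T.1) T.2 m m' 0 * G 0 1 + p1EdgeVec a h (p1Par T.1) T.2 m m' 1 * G 1 1 + p1EdgeVec a h (p1Par T.1) T.2 m m' 2 * G 2 1) ^ 2 +
         (p1EdgeVec a h (p1Par T.1) T.2 m m' 0 * G 0 2 + p1EdgeVec a h (p1Par T.1) T.2 m m' 1 * G 1 2 + p1EdgeVec a h (p1Par T.1) T.2 m m' 2 * G 2 2) ^ 2)) =
      p1CellJ a h p T * (p1ClassForm a h (p1Par T.1) T.2 (fun j => G j 0) + p1ClassForm a h (p1Par T.1) T.2 (fun j => G j 1) +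
        p1ClassForm a h (p1Par T.1) T.2 (fun j => G j 2)) := by
    simp only [p1ClassForm, mul_add, Finset.sum_add_distrib, Finset.mul_sum]
  have hread : ∑ m : Fin 4, ∑ m' : Fin 4, p1CellJ a h p T * (p1LoadCoef a h (p1Par T.1) T.2 m m' *
        ((p1EdgeVec a h (p1Par T.1) T.2 m m' 0 * G 0 0 + p1EdgeVec a h (p1Par T.1) T.2 m m' 1 * G 1 0 + p1EdgeVec a h (p1Par T.1) T.2 m m' 2 * G 2 0) ^ 2 +
         (p1EdgeVec a h (p1Par T.1) T.2 m m' 0 * G 0 1 + p1EdgeVec a h (p1Par T.1) T.2 m m' 1 * G 1 1 + p1EdgeVec a h (p1Par T.1) T.2 m m' 2 * G 2 1) ^ 2 +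
         (p1EdgeVec a h (p1Par T.1) T.2 m m' 0 * G 0 2 + p1EdgeVec a h (p1Par T.1) T.2 m m' 1 * G 1 2 + p1EdgeVec a h (p1Par T.1) T.2 m m' 2 * G 2 2) ^ 2)) ≤
      p1CellJ a h p T * (31 / 200 * fpFrob G) := by
    rw [hsum]
    refine mul_le_mul_of_nonneg_left ?_ (p1CellJ_nonneg a h p T)
    have c0 := classForm_le ha1 hh1 hh2 (p1Par T.1) T.2 (fun j => G j 0)
    have c1 := classForm_le ha1 hh1 hh2 (p1Par T.1) T.2 (fun j => G j 1)
    have c2 := classForm_le ha1 hh1 hh2 (p1Par T.1) T.2 (fun j => G j 2)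
    simp only [fpFrob]
    linarith
  -- Step 3: the exact radial defect of a far cell, circumradius form
  have hdef := p1CellDefectG_far_le_circ ha hh (by linarith) (by linarith) (by norm_num : (0 : ℝ) ≤ (193 / 125) * ((7 * (5 / 4 : ℝ) + 3 / 4) / 4))
    (by norm_num : (7 : ℝ) ≤ 20) p T hfar G
  -- Step 4: collect; all atoms opaque from here on
  have hJ0 := p1CellJ_nonneg a h p T
  have hFr0 : 0 ≤ fpFrob G := by unfold fpFrob; positivity
  have hρ : (a ^ 2 / 3 + h ^ 2 / 4) / ((20 - 3 / 2) ^ 2 * a ^ 2) ≤ 1462 / 1000000 := by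
    rw [div_le_iff₀ (by positivity)]
    have : h ^ 2 ≤ (81657 / 100000 * a) ^ 2 := pow_le_pow_left₀ hh.le hρ2 2
    nlinarith
  have hJint : (∫ y in p1RealCell a h T, fpChi ((81 / 20 * a) ^ 2) ((27 / 5 * a) ^ 2) (y - fun k => hcpSite a h p k) ^ 2 *
      (fpSq (y - fun k => hcpSite a h p k))⁻¹ ^ 3) = p1CellJ a h p T := rfl
  rw [hJint]
  refine le_trans (add_le_add (le_trans (Finset.sum_le_sum fun m _ => Finset.sum_le_sum fun m' _ => hpairs m m') hread) hdef) ?_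
  have hprod : 0 ≤ fpFrob G * p1CellJ a h p T := mul_nonneg hFr0 hJ0
  revert hprod
  generalize p1CellJ a h p T = J
  generalize fpFrob G = F
  generalize fpSymSq G = S
  intro hprod
  have e1 : J * (31 / 200 * F) + 193 / 125 * ((7 * (5 / 4 : ℝ) + 3 / 4) / 4) * (a ^ 2 / 3 + h ^ 2 / 4) / ((20 - 3 / 2) ^ 2 * a ^ 2) * F * J =
      (31 / 200 + 193 / 125 * ((7 * (5 / 4 : ℝ) + 3 / 4) / 4) * ((a ^ 2 / 3 + h ^ 2 / 4) / ((20 - 3 / 2) ^ 2 * a ^ 2))) * (F * J) := by ring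
  have e2 : (193 / 125 : ℝ) * ((5 / 2 * (1 / 24 * S) + 5 / 2 * (1 / 24 * (F - S))) * J) = 193 / 125 * (5 / 48) * (F * J) := by ring
  rw [e1, e2]
  revert hρ
  generalize (a ^ 2 / 3 + h ^ 2 / 4) / ((20 - 3 / 2) ^ 2 * a ^ 2) = ρ
  intro hρ
  nlinarith [mul_le_mul_of_nonneg_right hρ hprod]

/-! ## The `20a` cell box and the endpoint -/

/-- **The `20a` CELL box**: cube indices `Icc(p.1 ± 27) × Icc(p.2.1 ± 35) × Icc(p.2.2 ± 24)` (part 83's `20a` site box widened by one). [folklore] -/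
def p1CellBox20 (p : ℤ × ℤ × ℤ) : Finset (ℤ × ℤ × ℤ) :=
  Finset.Icc (p.1 - 27) (p.1 + 27) ×ˢ (Finset.Icc (p.2.1 - 35) (p.2.1 + 35) ×ˢ Finset.Icc (p.2.2 - 24) (p.2.2 + 24))

/-- **Every vertex of a cell outside the `20a` cell box is `≥ 20a` from `y_p`** (vertex offsets lie in `{0,1}³`; part 83's site box). -/
theorem far_of_not_mem_cellBox20 {a h : ℝ} (ha : 0 < a) (hlo : 3 / 4 * a ≤ h) (p : ℤ × ℤ × ℤ) (T : (ℤ × ℤ × ℤ) × Fin 6)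
    (hT : T.1 ∉ p1CellBox20 p) (b : Bool) (m : Fin 4) : 20 * a ≤ ‖hcpSite a h (T.1 + p1VertOff b T.2 m) - hcpSite a h p‖ := by
  refine twenty_le_of_not_mem_tailBox ha hlo p _ fun hmem => hT ?_
  have ho := p1VertOff_mem_p1Corners b T.2 m
  have hco : ∀ o ∈ p1Corners, (0 ≤ o.1 ∧ o.1 ≤ 1) ∧ (0 ≤ o.2.1 ∧ o.2.1 ≤ 1) ∧ (0 ≤ o.2.2 ∧ o.2.2 ≤ 1) := by decide
  obtain ⟨h1, h2, h3⟩ := hco _ ho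
  simp only [p1CellBox20, Finset.mem_product, Finset.mem_Icc] at hmem ⊢
  simp only [Prod.fst_add, Prod.snd_add] at hmem
  omega

/-- **H12⋆ ON THE BOX FROM FIVE CLOSED, FINITE CERTIFICATE STATEMENTS — (B∃) ON THE `20a` BOX.**  Part 93's `coreJointCoercive_cell_of_certificates₁₂`
with hypothesis (B∃_fin) asked only for the cells with a vertex WITHIN `20a` of `y_p` — all in the explicit finite box `p1CellBox20 p` — for allocation
tables that follow the EXACT RULE `θ = θv = p1ThetaX` on every cell whose four vertices are `≥ 20a` away (rule v31 of the certificate is the exact rule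
from `12.3a` on); every such cell is `farCell_budget20`.  The certificate side is now the direct per-cell certifier ALONE (cellval.py, rule v31,
`rc ≤ 21.0a`); the closed-form tail engine celltail.py is no longer load-bearing.  Moreover the budget is asked only for the cells that CARRY
LOAD under the chosen tables (`∃ e, θ e T ≠ 0 ∨ θv e T ≠ 0`): an unloaded cell satisfies it by `defect_only_budget` (every cell, in the kernel) — so
the hypothesis is literally the list of cells the certifier allocates to (gen-40 audit: the inner `χ = 0` cells and 24 + 60 one-vertex slivers at
`√17·a` are not in cellval's list; they carry no load).  (S_fin), (TAB), (PAY_near), (NC∃) verbatim.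
NOT a proof of H12⋆ (the five finite hypotheses are verified outside the kernel), NOT summit progress. -/
theorem coreJointCoercive_cell_of_certificates₁₃ {a h : ℝ} (ha : 0 < a) (hh : 0 < h) (hfam : HcpFamilyMin a h)
    -- (B∃_fin, 20a) THE PER-CELL BUDGET at each representative FOR SOME allocation tables that follow the EXACT RULE on the cells ≥ 20a away, asked only for the FINITELY MANY cells of the 20a cell box with a vertex within 20a THAT CARRY LOAD under the tables
    (hB : ∀ p ∈ ({(0, 0, 0), (1, 0, 0)} : Finset (ℤ × ℤ × ℤ)),
      ∃ θ θv : (ℤ × ℤ × ℤ) × (ℤ × ℤ × ℤ) → (ℤ × ℤ × ℤ) × Fin 6 → ℝ,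
        (∀ e T, 0 ≤ θ e T) ∧ (∀ e, (Function.support (θ e)).Finite) ∧ (∀ T, (Function.support fun e => θ e T).Finite) ∧
        (∀ e, p1FarW a h (p1Phi0 p) p e ≠ 0 → ∑ᶠ T, θ e T = 1) ∧
        (∀ e T, θ e T ≠ 0 → ∃ m m' : Fin 4, e.1 = T.1 + p1VertOff (p1Par T.1) T.2 m ∧
          e.1 + e.2 = T.1 + p1VertOff (p1Par T.1) T.2 m') ∧
        (∀ e T, 0 ≤ θv e T) ∧ (∀ e, (Function.support (θv e)).Finite) ∧ (∀ T, (Function.support fun e => θv e T).Finite) ∧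
        (∀ e, (∑ i : Fin 3, (2 / 3) * ((if e.2 = p1RouteOff e.1 i then p1FarWv a h (p1Phi0 p) p e.1 else 0) +
          (if p1RouteOff (e.1 - (p1SV - e.2)) i = p1SV - e.2 then p1FarWv a h (p1Phi0 p) p (e.1 - (p1SV - e.2)) else 0))) ≠ 0 → ∑ᶠ T, θv e T = 1) ∧
        (∀ e T, θv e T ≠ 0 → ∃ m m' : Fin 4, e.1 = T.1 + p1VertOff (p1Par T.1) T.2 m ∧
          e.1 + e.2 = T.1 + p1VertOff (p1Par T.1) T.2 m') ∧
        (∀ T : (ℤ × ℤ × ℤ) × Fin 6, (∀ m : Fin 4, 20 * a ≤ ‖hcpSite a h (T.1 + p1VertOff (p1Par T.1) T.2 m) - hcpSite a h p‖) →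
          ∀ e, θ e T = p1ThetaX a h p e T ∧ θv e T = p1ThetaX a h p e T) ∧
        ∀ (T : (ℤ × ℤ × ℤ) × Fin 6), T.1 ∈ p1CellBox20 p →
          (∃ m : Fin 4, ‖hcpSite a h (T.1 + p1VertOff (p1Par T.1) T.2 m) - hcpSite a h p‖ < 20 * a) → (∃ e, θ e T ≠ 0 ∨ θv e T ≠ 0) →
          ∀ (G : Fin 3 → Fin 3 → ℝ),
      (∑ᶠ e : (ℤ × ℤ × ℤ) × (ℤ × ℤ × ℤ), θ e T * p1FarW a h (p1Phi0 p) p e *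
          fpSq (fun k => (hcpSite a h (e.1 + e.2) 0 - hcpSite a h e.1 0) * G 0 k +
            (hcpSite a h (e.1 + e.2) 1 - hcpSite a h e.1 1) * G 1 k + (hcpSite a h (e.1 + e.2) 2 - hcpSite a h e.1 2) * G 2 k)) +
      (∑ᶠ e : (ℤ × ℤ × ℤ) × (ℤ × ℤ × ℤ), θv e T *
          (∑ i : Fin 3, (2 / 3) * ((if e.2 = p1RouteOff e.1 i then p1FarWv a h (p1Phi0 p) p e.1 else 0) +
            (if p1RouteOff (e.1 - (p1SV - e.2)) i = p1SV - e.2 then p1FarWv a h (p1Phi0 p) p (e.1 - (p1SV - e.2)) else 0))) *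
          fpSq (fun k => (hcpSite a h (e.1 + e.2) 0 - hcpSite a h e.1 0) * G 0 k +
            (hcpSite a h (e.1 + e.2) 1 - hcpSite a h e.1 1) * G 1 k + (hcpSite a h (e.1 + e.2) 2 - hcpSite a h e.1 2) * G 2 k)) +
      p1CellDefectG a h (fun y k l => (193 / 125) * ((7 * (5 / 4 : ℝ) + 3 / 4) / 4) * fpChi ((81 / 20 * a) ^ 2) ((27 / 5 * a) ^ 2) (y - fun k => hcpSite a h p k) ^ 2 *
          (fpSq (y - fun k => hcpSite a h p k))⁻¹ ^ 5 * ((y - fun k => hcpSite a h p k) k * (y - fun k => hcpSite a h p k) l)) T G ≤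
      (193 / 125) * ((5 / 2 * (1 / 24 * fpSymSq G) + 5 / 2 * (1 / 24 * (fpFrob G - fpSymSq G))) *
        ∫ y in p1RealCell a h T, fpChi ((81 / 20 * a) ^ 2) ((27 / 5 * a) ^ 2) (y - fun k => hcpSite a h p k) ^ 2 * (fpSq (y - fun k => hcpSite a h p k))⁻¹ ^ 3))
    -- (S_fin) per-site domination off the PINNED reach set at the FINITELY MANY sites of the 20a index box with `‖y_q − y_p‖ < 20a`; (TAB) the PINNED certified tables
    (hS : ∀ p ∈ ({(0, 0, 0), (1, 0, 0)} : Finset (ℤ × ℤ × ℤ)),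
      ∀ q ∈ Finset.Icc (p.1 - 26) (p.1 + 26) ×ˢ (Finset.Icc (p.2.1 - 34) (p.2.1 + 34) ×ˢ Finset.Icc (p.2.2 - 23) (p.2.2 + 23)),
      q ∉ p1QB p → q ≠ p → ‖hcpSite a h q - hcpSite a h p‖ < 20 * a → ∀ z : Fin 3 → ℝ,
      0 ≤ 1 / 2 * (ljSqDeriv (‖hcpSite a h q - hcpSite a h p‖ ^ 2) * fpSq z +
          2 * (1 / 2 * (7 * ((‖hcpSite a h q - hcpSite a h p‖ ^ 2)⁻¹) ^ 8 -
            4 * ((‖hcpSite a h q - hcpSite a h p‖ ^ 2)⁻¹) ^ 5)) * p1NRad a h p (fun _ => z) q ^ 2) +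
        p1SiteBare a h (fun y k l => (193 / 125) * ((7 * (5 / 4 : ℝ) + 3 / 4) / 4) * fpChi ((81 / 20 * a) ^ 2) ((27 / 5 * a) ^ 2) (y - fun k => hcpSite a h p k) ^ 2 *
          (fpSq (y - fun k => hcpSite a h p k))⁻¹ ^ 5 * ((y - fun k => hcpSite a h p k) k * (y - fun k => hcpSite a h p k) l)) (fun _ => z) q -
        p1SiteBare a h (fun y k l => (193 / 125) * ((3 / 4 : ℝ) / 4) * fpChi ((81 / 20 * a) ^ 2) ((27 / 5 * a) ^ 2) (y - fun k => hcpSite a h p k) ^ 2 *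
          (fpSq (y - fun k => hcpSite a h p k))⁻¹ ^ 4 * (if k = l then 1 else 0)) (fun _ => z) q)
    (hTab : ∀ p ∈ ({(0, 0, 0), (1, 0, 0)} : Finset (ℤ × ℤ × ℤ)), ∀ q ∈ p1QB p, q ≠ p → ∀ z : Fin 3 → ℝ,
      (p1LU p q).1 * p1NRad a h p (fun _ => z) q ^ 2 ≤
        p1SiteBare a h (fun y k l => (193 / 125) * ((7 * (5 / 4 : ℝ) + 3 / 4) / 4) * fpChi ((81 / 20 * a) ^ 2) ((27 / 5 * a) ^ 2) (y - fun k => hcpSite a h p k) ^ 2 *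
          (fpSq (y - fun k => hcpSite a h p k))⁻¹ ^ 5 * ((y - fun k => hcpSite a h p k) k * (y - fun k => hcpSite a h p k) l)) (fun _ => z) q ∧
      p1SiteBare a h (fun y k l => (193 / 125) * ((3 / 4 : ℝ) / 4) * fpChi ((81 / 20 * a) ^ 2) ((27 / 5 * a) ^ 2) (y - fun k => hcpSite a h p k) ^ 2 *
          (fpSq (y - fun k => hcpSite a h p k))⁻¹ ^ 4 * (if k = l then 1 else 0)) (fun _ => z) q ≤ (p1LU p q).2 * fpSq z)
    -- (PAY_near) the far table's column sums over the FINITELY MANY sites of the 44a box WITHIN 44a of y_p, by the PINNED payments minus the kernel's far allowance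
    (hPAY : ∀ p ∈ ({(0, 0, 0), (1, 0, 0)} : Finset (ℤ × ℤ × ℤ)), ∀ s ∈ p1BondOffsets, (193 / 125) * (2 / 5) / a ^ 4 *
      (∑ q ∈ Finset.Icc (p.1 - 53) (p.1 + 53) ×ˢ (Finset.Icc (p.2.1 - 69) (p.2.1 + 69) ×ˢ Finset.Icc (p.2.2 - 51) (p.2.2 + 51)),
        if ‖hcpSite a h q - hcpSite a h p‖ < 44 * a then
          p1RecTable a h (p1SplitDensity (81 / 20 * a) (27 / 5 * a)) (decide (Even p.1)) (q - p) s else 0) ≤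
      p1Paym p s - 3 / 200000 * p1BondW (fun _ => (1 : ℝ)) p s)
    -- (NC∃) THE NEAR CERTIFICATE WITH THE EXACT COLLAR FLUX at both representatives, FOR SOME stencilled decaying finitely supported near tables
    (hNC : ∃ M₁ N : Bool → (ℤ × ℤ × ℤ) → (ℤ × ℤ × ℤ) → (ℤ × ℤ × ℤ) → ℝ, ∃ QT : (ℤ × ℤ × ℤ) → Finset (ℤ × ℤ × ℤ),
      (∀ b d s s', s ∉ p1BondOffsets ∨ s' ∉ p1BondOffsets → M₁ b d s s' = 0 ∧ N b d s s' = 0) ∧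
      (∃ C₁ : ℝ, ∀ p q : ℤ × ℤ × ℤ, ∀ s s', |M₁ (decide (Even p.1)) (q - p) s s'| ≤
        C₁ * ((1 + ‖hcpSite a h q - hcpSite a h p‖)⁻¹) ^ 6 ∧
      |N (decide (Even p.1)) (q - p) s s'| ≤ C₁ * ((1 + ‖hcpSite a h q - hcpSite a h p‖)⁻¹) ^ 6) ∧
      (∀ p ∈ ({(0, 0, 0), (1, 0, 0)} : Finset (ℤ × ℤ × ℤ)), ∀ q : ℤ × ℤ × ℤ, q ∉ QT p → ∀ s s',
      M₁ (decide (Even p.1)) (q - p) s s' = 0 ∧ M₁ (decide (Even q.1)) (p - q) s s' = 0 ∧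
      N (decide (Even p.1)) (q - p) s s' = 0 ∧ N (decide (Even q.1)) (p - q) s' s = 0) ∧
      ∀ p ∈ ({(0, 0, 0), (1, 0, 0)} : Finset (ℤ × ℤ × ℤ)), ∀ V : ℤ × ℤ × ℤ → (Fin 3 → ℝ), V p = 0 →
      (∀ Z : Fin 3 → Fin 3 → ℝ, (∀ j k, Z j k = -Z k j) →
        ∑ q ∈ (if Even p.1 then hcpStarIdx.image (fun d => d + p) else hcpStarIdx.image (fun d => p - d)), ∑ k : Fin 3, V q k * (∑ j : Fin 3, (hcpSite a h q j - hcpSite a h p j) * Z j k) = 0) →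
      0 ≤ p1NearForm a h (1 / 3) (1 / 12) (193 / 125) p p1Stencil (p1Beta a h) M₁ N (p1FarW a h (p1Phi0 p) p) p1SV (p1FarWv a h (p1Phi0 p) p) (fun s => -p1Beta a h (decide (Even p.1)) 0 s) (if Even p.1 then hcpStarIdx.image (fun d => d + p) else hcpStarIdx.image (fun d => p - d)) (p1QB p) (QT p) ∅ (p1FarLegs (p1Phi0 p) p) (fun q => (p1LU p q).1) (fun q => (p1LU p q).2) (p1Paym p) (fun _ => 0) (fun _ _ => 0) V -
        193 / 125 * p1ExactFluxSum a h p V) :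
    CoreJointCoercive a h (1 / 3) (1 / 12) := by
  obtain ⟨hρ1, hρ2⟩ := ratioBox_of_hcpFamilyMin ha hh hfam
  have hlo : 3 / 4 * a ≤ h := by linarith
  refine coreJointCoercive_cell_of_certificates₁₂ ha hh hfam (fun p hp => ?_) hS hTab hPAY hNC
  obtain ⟨θ, θv, h1, h2, h3, h4, h5, h6, h7, h8, h9, h10, hX, hfin⟩ := hB p hp
  refine ⟨θ, θv, h1, h2, h3, h4, h5, h6, h7, h8, h9, h10, fun T hT44 => hX T fun m => le_trans (by linarith) (hT44 m), fun T _ _ G => ?_⟩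
  by_cases hload : ∃ e, θ e T ≠ 0 ∨ θv e T ≠ 0
  swap
  · -- an unloaded cell: both readout sums vanish, the defect alone is within budget (`defect_only_budget`)
    push Not at hload
    have e1 : (∑ᶠ e : (ℤ × ℤ × ℤ) × (ℤ × ℤ × ℤ), θ e T * p1FarW a h (p1Phi0 p) p e *
        fpSq (fun k => (hcpSite a h (e.1 + e.2) 0 - hcpSite a h e.1 0) * G 0 k +
          (hcpSite a h (e.1 + e.2) 1 - hcpSite a h e.1 1) * G 1 k + (hcpSite a h (e.1 + e.2) 2 - hcpSite a h e.1 2) * G 2 k)) = 0 :=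
      finsum_eq_zero_of_forall_eq_zero fun e => by rw [(hload e).1, zero_mul, zero_mul]
    have e2 : (∑ᶠ e : (ℤ × ℤ × ℤ) × (ℤ × ℤ × ℤ), θv e T *
          (∑ i : Fin 3, (2 / 3) * ((if e.2 = p1RouteOff e.1 i then p1FarWv a h (p1Phi0 p) p e.1 else 0) +
            (if p1RouteOff (e.1 - (p1SV - e.2)) i = p1SV - e.2 then p1FarWv a h (p1Phi0 p) p (e.1 - (p1SV - e.2)) else 0))) *
          fpSq (fun k => (hcpSite a h (e.1 + e.2) 0 - hcpSite a h e.1 0) * G 0 k +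
            (hcpSite a h (e.1 + e.2) 1 - hcpSite a h e.1 1) * G 1 k + (hcpSite a h (e.1 + e.2) 2 - hcpSite a h e.1 2) * G 2 k)) = 0 :=
      finsum_eq_zero_of_forall_eq_zero fun e => by rw [(hload e).2, zero_mul, zero_mul]
    rw [e1, e2, zero_add, zero_add]
    exact defect_only_budget ha hh (by linarith) (by linarith) p T G
  by_cases hfar : ∀ m : Fin 4, 20 * a ≤ ‖hcpSite a h (T.1 + p1VertOff (p1Par T.1) T.2 m) - hcpSite a h p‖
  swap
  · have hnear : ∃ m : Fin 4, ‖hcpSite a h (T.1 + p1VertOff (p1Par T.1) T.2 m) - hcpSite a h p‖ < 20 * a := by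
      by_contra hc
      exact hfar fun m => not_lt.1 fun hm => hc ⟨m, hm⟩
    have hT : T.1 ∈ p1CellBox20 p := by
      by_contra hT
      obtain ⟨m, hm⟩ := hnear
      exact absurd (far_of_not_mem_cellBox20 ha hlo p T hT (p1Par T.1) m) (not_le.2 hm)
    exact hfin T hT hnear hload G
  · have hX' := hX T hfar
    have hbud := farCell_budget20 ha hh hfam p T hfar G
    have e1 := finsum_congr (f := fun e : (ℤ × ℤ × ℤ) × (ℤ × ℤ × ℤ) => θ e T * p1FarW a h (p1Phi0 p) p e *
        fpSq (fun k => (hcpSite a h (e.1 + e.2) 0 - hcpSite a h e.1 0) * G 0 k +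
          (hcpSite a h (e.1 + e.2) 1 - hcpSite a h e.1 1) * G 1 k + (hcpSite a h (e.1 + e.2) 2 - hcpSite a h e.1 2) * G 2 k))
      (g := fun e => p1ThetaX a h p e T * p1FarW a h (p1Phi0 p) p e *
        fpSq (fun k => (hcpSite a h (e.1 + e.2) 0 - hcpSite a h e.1 0) * G 0 k +
          (hcpSite a h (e.1 + e.2) 1 - hcpSite a h e.1 1) * G 1 k + (hcpSite a h (e.1 + e.2) 2 - hcpSite a h e.1 2) * G 2 k))
      (fun e => by rw [(hX' e).1])
    have e2 := finsum_congr (f := fun e : (ℤ × ℤ × ℤ) × (ℤ × ℤ × ℤ) => θv e T *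
          (∑ i : Fin 3, (2 / 3) * ((if e.2 = p1RouteOff e.1 i then p1FarWv a h (p1Phi0 p) p e.1 else 0) +
            (if p1RouteOff (e.1 - (p1SV - e.2)) i = p1SV - e.2 then p1FarWv a h (p1Phi0 p) p (e.1 - (p1SV - e.2)) else 0))) *
          fpSq (fun k => (hcpSite a h (e.1 + e.2) 0 - hcpSite a h e.1 0) * G 0 k +
            (hcpSite a h (e.1 + e.2) 1 - hcpSite a h e.1 1) * G 1 k + (hcpSite a h (e.1 + e.2) 2 - hcpSite a h e.1 2) * G 2 k))
      (g := fun e => p1ThetaX a h p e T *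
          (∑ i : Fin 3, (2 / 3) * ((if e.2 = p1RouteOff e.1 i then p1FarWv a h (p1Phi0 p) p e.1 else 0) +
            (if p1RouteOff (e.1 - (p1SV - e.2)) i = p1SV - e.2 then p1FarWv a h (p1Phi0 p) p (e.1 - (p1SV - e.2)) else 0))) *
          fpSq (fun k => (hcpSite a h (e.1 + e.2) 0 - hcpSite a h e.1 0) * G 0 k +
            (hcpSite a h (e.1 + e.2) 1 - hcpSite a h e.1 1) * G 1 k + (hcpSite a h (e.1 + e.2) 2 - hcpSite a h e.1 2) * G 2 k))
      (fun e => by rw [(hX' e).2])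
    rw [e1, e2]
    exact hbud

end Summit.AtomisticToContinuum.Crystallization.Theorems.StrictSplittingRuleBirth

end
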